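import Mathlib
import Summits.NavierStokesRegularity.NavierStokesRegularity.Theorems.TaoLadderRungTwoFlatTubeBlockFlow
import HarnessLib

/-!
# THE TUBE-HOP ROWS `hcore2`, `hwinA`, `hVt` FROM A CONDITIONAL CORE-BLOCK ENCLOSURE (class level; W-34 / A70-3 at hops `n > N₀`)
  (helper for the K_A♭ parent item stmt-NavierStokesRegularity-22987 `FlatGapCertificatesV2`, child 2A, route TaoLadderRungTwoFlat;
  cell harvest/h2-tao-ladder, p1 g25)

* `tubeRows_of_conditionalBlock` — at a tube hop `n > N₀` (`Bcl ⇒ behindR54`): the CONDITIONAL core-block row over the premise class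
  (block `[2−K, k_H+1]` against the co-scaled reference family `W z`; interface boxes `2RBAR`, `2BBAR` at `1−K`, `4G_{k_H+1}` at
  `k_H+2`), `D_{2−K} ≤ ρ₂`, the schedule of the interface loop of record (…NearBehindStepIface), the section datum, the hull row
  `|W z₁(k_H+1)| + D_{k_H+1} ≤ V_top`, the first cut's rows and the ahead window rows `8w_k(|W z_{i,1+k}| + D_{1+k}) ≤ r·AFL`
  give UNCONDITIONALLY the three flow-dependent inputs of `tubeStep_of_schedule_split` (…TubeStepSplit): `hcore2`, `hwinA`
  (`AheadWindowWith`), `hVt`, plus the interface levels on `[0, t]` at good times (`tubeBlock_closure` per premise); the conditional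
  row and the section datum are stated ONCE over all kick-ball flows of `H(n)` on any horizon, so that the same rows serve
* `tubeLevels_of_conditionalBlock_ball` — along the SHORT kick-ball flows (`[0, s]`, `s ≤ c₀`): the window levels `|S_{ik}| ≤ M^W_k + D_k`
  on `[2−K, k_H+1]`, the cut envelope beyond and the interface levels — the window part of the K4 input `hlev` of `apriori_tube_uniform`.

HONEST FRAMING: composition over the cell's typed frame (MODEL lattice); the conditional block row, the reference family and its rows
are BOOKED HYPOTHESES; nothing certified; no item closed; nothing about the Navier–Stokes equations.
-/

noncomputable section

-- the sub-problem namespace repeats the summit name by design (D-0017)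
set_option linter.dupNamespace false

namespace Summit.NavierStokesRegularity.NavierStokesRegularity.Theorems.HopTube

open Set Finset Filter Topology Literature.Analysis.FluidPDE Literature.Analysis.FluidPDE.TaoCascade MirrorPulse RenormFrame QuadPolar
  GappedFrontRobustOn

section Class

variable {ε ε₀ : ℝ}

set_option maxHeartbeats 800000 in
/-- **THE TUBE-HOP ROWS FROM A CONDITIONAL CORE-BLOCK ENCLOSURE (class level).** At a tube hop `n > N₀` (`Bcl ⇒ behindR54`), the
conditional core-block row — stated ONCE over all kick-ball flows of `H(n)` on any horizon, conditional up to `min(s, c₀)` — (block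
`[2−K, k_H+1]` against the co-scaled reference `W z`; boxes `2RBAR`, `2BBAR` at `1−K` and `4G_{k_H+1}` at `k_H+2`), `D_{2−K} ≤ ρ₂`, the schedule of the interface loop of record, the section datum, the hull row
`|W z₁(k_H+1)| + D_{k_H+1} ≤ V_top`, the first cut's rows and the ahead window rows `8w_k(|W z_{i,1+k}| + D_{1+k}) ≤ r·AFL` give the
three flow-dependent inputs of `tubeStep_of_schedule_split` UNCONDITIONALLY — `hcore2`, `hwinA` (`AheadWindowWith`), `hVt` — and the
interface levels `(RBAR, BBAR)` on `[0, t]` at every good time.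
[cite: Tao2016AveragedNS, §4 (4.1)–(4.8), §5, §6.2 Prop. 6.3 (ix), §6.3–6.4 (statement shape); cell LADDER §59–§62, §70 (A70-3, W-34)] -/
theorem tubeRows_of_conditionalBlock (P : TubeSchedule) {θ' : ℝ} {Wb : ℕ → ℝ} {i₀ : Fin 2}
    {Bcl : ℕ → (Fin 2 → ℤ → ℝ) → Prop} (hBcl : ∀ m z, Bcl m z → behindR54 P θ' Wb m z)
    {X₀ : Fin 2 → ℝ} {w : ℤ → ℝ} {r c₀ : ℝ} {ζ : ℕ → Fin 2 → ℤ → ℝ} {ustar : Fin 2 → ℤ → ℝ} {n : ℕ}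
    {good : ℕ → (Fin 2 → ℤ → ℝ → ℝ) → ℝ → Prop}
    {cW κ₂ : ℝ} {W₀ FW₀ BW₀ : (Fin 2 → ℤ → ℝ) → Fin 2 → ℤ → ℝ} {W FW : (Fin 2 → ℤ → ℝ) → Fin 2 → ℤ → ℝ → ℝ}
    (hWflow : ∀ z, InTubeWith P Bcl i₀ X₀ w r ζ ustar n z →
      PseudoFlowOnShift shiftSetFlat cW ε₀ (mirrorTable ε ε) 0 κ₂ (W₀ z) (FW₀ z) (BW₀ z) (W z) (FW z)) (hcW : c₀ ≤ cW)
    (hε : 0 ≤ ε) (hε₀ : 0 < ε₀) (hn : P.N₀ < n) (hK : 1 ≤ P.K) (hDK : P.K + 1 ≤ P.D) (hθV : 0 < P.θV)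
    (hθ : 0 < θ') (hθ5 : θ' ≤ 5 * Real.log (1 + ε₀)) (hw1 : ∀ k, 1 ≤ w k) (hr0 : 0 ≤ r) (hc₀ : 0 < c₀) (hk₁ : 1 ≤ P.k₁)
    (hAstar : 0 < P.Astar) {ωK MuK : ℝ} (hωK : 0 < ωK)
    (hωKle : ∀ i, ωK ≤ MirrorPulse.geomGauge P.g P.b i (-(P.K : ℤ))) (hMuK : ∀ i, |ustar i (-(P.K : ℤ))| ≤ MuK)
    (hWbn : 0 ≤ Wb n)
    {Aeff A A₀ A₁ M M₁ M₂ rI RBAR BBAR RHO2 rs I₁ I₂ PUMP μN μB VbarN VbarB EW V₀N V₀B EN : ℝ}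
    (hAeff : 0 < Aeff) (hM0 : 0 ≤ M)
    (hM : ∀ z, InTubeWith P Bcl i₀ X₀ w r ζ ustar n z →
      ∀ s ∈ Icc 0 c₀, ∀ i, ∀ m ∈ Finset.Icc (-(P.D : ℤ)) (1 - (P.K : ℤ)), |W z i m s| ≤ M)
    (hM₁ : ∀ z, InTubeWith P Bcl i₀ X₀ w r ζ ustar n z → ∀ s ∈ Icc 0 c₀, |W z 1 (-(P.K : ℤ)) s| ≤ M₁)
    (hM₂0 : 0 ≤ M₂)
    (hM₂ : ∀ z, InTubeWith P Bcl i₀ X₀ w r ζ ustar n z → ∀ s ∈ Icc 0 c₀, |W z 0 (2 - (P.K : ℤ)) s| ≤ M₂)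
    (hEW : ∀ z, InTubeWith P Bcl i₀ X₀ w r ζ ustar n z →
      coMovingEnergyOn (Finset.Icc (1 - (P.D : ℤ)) (-(P.K : ℤ))) P.θV (-(P.K : ℝ))
        (fun i k _ => anchorScale P i₀ z * ustar i k - W₀ z i k) 0 ≤ EW)
    (hρ0 : 0 ≤ RHO2)
    (hRB0 : 0 < RBAR) (hBB0 : 0 < BBAR) (hRr : RBAR ≤ rI) (hBr : BBAR ≤ rI) (hVN0 : 0 ≤ VbarN)
    (hI₁0 : 0 ≤ I₁) (hI₂0 : 0 ≤ I₂)
    (hI₁ : 2 * (Real.exp (P.θV / 2) - 1) ≤ I₁ * P.θV) (hI₂ : Real.exp P.θV - 1 ≤ I₂ * P.θV)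
    (hPUMPdef : PUMP = 1 * c₀ * ((2 + ε) * M * I₁ * Real.sqrt (2 * VbarN) + 2 * I₂ * VbarN))
    (hlevC : rs + PUMP + 1 * c₀ * ((ε * (M + I₁ * Real.sqrt (2 * VbarN)) + ε * M + ε * BBAR) * RBAR
      + (2 + ε) * M * BBAR + BBAR ^ 2) < RBAR)
    (hlevV : rs + 1 * c₀ * ((M + M₂ + RBAR + RHO2) * BBAR + (1 + 2 * ε) * M * RBAR + ε * RBAR ^ 2
      + (M + 2 * ε * M₂) * RHO2 + ε * RHO2 ^ 2) < BBAR)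
    (hAdef : A = Real.sqrt (2 * VbarB) * Real.exp (θ' / 2) * Real.exp (θ' * ((P.D : ℝ) - P.K) / 2) + M)
    (hA₀def : A₀ = M + rI) (hA₁def : A₁ = M₁ + Real.sqrt (2 * VbarN) * Real.exp (P.θV / 2))
    (hrA : rI ≤ A) (hA₀le : A₀ ≤ Aeff)
    (hV₀Ndef : V₀N = (Real.sqrt (P.v n + (P.δ n / ωK) ^ 2) + Real.sqrt P.D * r + Real.sqrt EW) ^ 2)
    (hV₀Bdef : V₀B = (Real.sqrt (Wb n + (MuK + P.δ n / ωK) ^ 2) + r / Real.sqrt (1 - Real.exp (-θ'))) ^ 2)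
    (hENdef : EN = Real.exp (P.θV * ((1 : ℝ) - P.D + P.K)) * ((1 + ε) * 1 * A ^ 2 * (A + M))
      + 1 * rI * (2 * VbarN + ε * rI * Real.sqrt (2 * VbarN) + (1 + ε) * M * rI))
    (hμN : 0 < μN)
    (hμNle : μN ≤ (1 / c₀) * P.θV - 2 * (1 + ε) * 1 * (A * Real.sinh (P.θV / 2) + M * (3 + Real.exp P.θV)))
    (hμB : 0 < μB) (hμBle : μB ≤ (1 / c₀) * θ' - 2 * (1 + ε) * Aeff * Real.sinh (θ' / 2))
    (hlevN : V₀N + EN * c₀ < VbarN) (hlevB : V₀B + A₁ * A₀ * (A₁ + ε * A₀) * c₀ < VbarB)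
    (hclose : Real.sqrt (2 * VbarB) * Real.exp (θ' / 2) ≤ Aeff)
    -- section datum (over all kick-ball flows of `H(n)`) and good times inside `(0, c₀]`
    (hsec : ∀ z S₀ s S F, InTubeWith P Bcl i₀ X₀ w r ζ ustar n z → (∀ i k, w k * |S₀ i k - z i k| ≤ r) → 0 < s →
      PseudoFlowOnShift shiftSetFlat s ε₀ (mirrorTable ε ε) 0 0 S₀ (fun i k => (1 / 2) * S₀ i k ^ 2) (fun _ _ => 0) S F →
        ∀ i, |(S - W z) i (1 - (P.K : ℤ)) 0| ≤ rs)
    (hwin : ∀ z S₀ τ S F, HopPremiseWith P Bcl shiftSetFlat ε₀ i₀ (mirrorTable ε ε) X₀ w r c₀ ζ ustar n z S₀ τ S F →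
      ∀ t, good n S t → 0 < t ∧ t ≤ c₀)
    -- THE CORE BLOCK `[2−K, k_H+1]`: conditional enclosure row over the class, profile rows, first cut, ahead window rows
    {kH : ℤ} (hKH : 2 - (P.K : ℤ) ≤ kH + 1) (hk₁H : (P.k₁ : ℤ) ≤ kH + 2) {Dk G Ω : ℤ → ℝ} {Vtop AFL : ℝ}
    (hGpos : 0 < G (kH + 1)) (hVtop : 0 ≤ Vtop)
    (hblock : ∀ z S₀ s S F, InTubeWith P Bcl i₀ X₀ w r ζ ustar n z → (∀ i k, w k * |S₀ i k - z i k| ≤ r) → 0 < s →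
      PseudoFlowOnShift shiftSetFlat s ε₀ (mirrorTable ε ε) 0 0 S₀ (fun i k => (1 / 2) * S₀ i k ^ 2) (fun _ _ => 0) S F →
        ∀ t ∈ Icc 0 c₀, t ≤ s →
          (∀ s' ∈ Icc 0 t, |(S - W z) 0 (1 - (P.K : ℤ)) s'| ≤ 2 * RBAR ∧ |(S - W z) 1 (1 - (P.K : ℤ)) s'| ≤ 2 * BBAR ∧
              ∀ i : Fin 2, |S i (kH + 1 + 1) s'| ≤ 4 * G (kH + 1)) →
            ∀ s' ∈ Icc 0 t, ∀ (i : Fin 2) (k : ℤ), 2 - (P.K : ℤ) ≤ k → k ≤ kH + 1 → |(S - W z) i k s'| ≤ Dk k)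
    (hρD : Dk (2 - (P.K : ℤ)) ≤ RHO2)
    (hrefV : ∀ z, InTubeWith P Bcl i₀ X₀ w r ζ ustar n z → ∀ s ∈ Icc 0 c₀, |W z 1 (kH + 1) s| + Dk (kH + 1) ≤ Vtop)
    (hΩ : ∀ j, kH < j → ∀ N : Finset ℤ, (∀ m ∈ N, j < m) → ∑ m ∈ N, (w m)⁻¹ ^ 2 ≤ Ω j)
    (hGΩ : ∀ j, kH < j → 2 * (9 / 8 * r) ^ 2 * Ω j ≤ G j ^ 2)
    (hclose0 : 4 / 3 * c₀ * clock ε₀ (kH + 1) * Vtop * (Vtop + 2 * ε * G (kH + 1)) < G (kH + 1))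
    (hrefA : ∀ z, InTubeWith P Bcl i₀ X₀ w r ζ ustar n z → ∀ t ∈ Icc 0 c₀, ∀ (i : Fin 2) (k : ℤ), (P.k₁ : ℤ) ≤ k → k ≤ kH →
      8 * (w k * (|W z i (1 + k) t| + Dk (1 + k))) ≤ r * AFL) :
    (∀ z S₀ τ S F, HopPremiseWith P Bcl shiftSetFlat ε₀ i₀ (mirrorTable ε ε) X₀ w r c₀ ζ ustar n z S₀ τ S F →
        ∀ t, good n S t → ∀ s ∈ Icc 0 t, |(S - W z) 0 (2 - (P.K : ℤ)) s| ≤ RHO2) ∧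
      AheadWindowWith P Bcl shiftSetFlat ε₀ i₀ (mirrorTable ε ε) X₀ w r c₀ ζ ustar good n kH AFL ∧
      (∀ z S₀ τ S F, HopPremiseWith P Bcl shiftSetFlat ε₀ i₀ (mirrorTable ε ε) X₀ w r c₀ ζ ustar n z S₀ τ S F →
        ∀ t ∈ Icc 0 c₀, |S 1 (kH + 1) t| ≤ Vtop) ∧
      (∀ z S₀ τ S F, HopPremiseWith P Bcl shiftSetFlat ε₀ i₀ (mirrorTable ε ε) X₀ w r c₀ ζ ustar n z S₀ τ S F →
        ∀ t, good n S t →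
          ∀ s ∈ Icc 0 t, |(S - W z) 0 (1 - (P.K : ℤ)) s| ≤ RBAR ∧ |(S - W z) 1 (1 - (P.K : ℤ)) s| ≤ BBAR) := by
  have hw0 : ∀ k, 0 < w k := fun k => lt_of_lt_of_le one_pos (hw1 k)
  -- the closure for every premise
  have hcl : ∀ z S₀ τ S F, HopPremiseWith P Bcl shiftSetFlat ε₀ i₀ (mirrorTable ε ε) X₀ w r c₀ ζ ustar n z S₀ τ S F →
      ∀ s ∈ Icc 0 c₀, (∀ (i : Fin 2) (k : ℤ), 2 - (P.K : ℤ) ≤ k → k ≤ kH + 1 → |(S - W z) i k s| ≤ Dk k) ∧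
        (|(S - W z) 0 (1 - (P.K : ℤ)) s| ≤ RBAR ∧ |(S - W z) 1 (1 - (P.K : ℤ)) s| ≤ BBAR) ∧
        (∀ (i : Fin 2) (m : ℤ), kH + 1 < m → |S i m s| ≤ 2 * G (kH + 1)) := by
    intro z S₀ τ S F hprem
    have hz := hprem.1
    have hkick := hprem.2.1
    have hz' := hz
    have h0 : n ≠ 0 := by omega
    have h1 : ¬ n ≤ P.N₀ := by omega
    simp only [InTubeWith, h0, if_false, h1] at hz'
    obtain ⟨-, -, -, -, hA⟩ := hz'
    have hinit : ∀ N : Finset ℤ, (∀ m ∈ N, kH + 1 < m) → ∑ m ∈ N, ∑ i : Fin 2, S₀ i m ^ 2 ≤ G (kH + 1) ^ 2 :=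
      fun N hN => (initialTail_le_of_clauses P hw0 hr0 hA hkick (j := kH + 1) (by omega) hN
        (hΩ (kH + 1) (by omega) N hN)).trans (hGΩ (kH + 1) (by omega))
    exact tubeBlock_closure P hBcl hWflow hcW hε hε₀ hn hK hDK hθV hθ hθ5 hw1 hr0 hc₀ hAstar hωK hωKle hMuK hWbn hAeff hM0 hM
      hM₁ hM₂0 hM₂ hEW hρ0 hRB0 hBB0 hRr hBr hVN0 hI₁0 hI₂0 hI₁ hI₂ hPUMPdef hlevC hlevV hAdef hA₀def hA₁def hrA hA₀le hV₀Ndef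
      hV₀Bdef hENdef hμN hμNle hμB hμBle hlevN hlevB hclose hz hkick hprem.2.2.2 hc₀ hprem.2.2.1 le_rfl
      (hsec z S₀ τ S F hz hkick (hc₀.trans_le hprem.2.2.1) hprem.2.2.2) hKH hGpos hVtop
      (fun t ht => hblock z S₀ τ S F hz hkick (hc₀.trans_le hprem.2.2.1) hprem.2.2.2 t ht (ht.2.trans hprem.2.2.1)) hρD
      (hrefV z hz) hinit hclose0
  refine ⟨?_, ?_, ?_, ?_⟩
  · intro z S₀ τ S F hprem t ht s hs
    obtain ⟨htpos, htc⟩ := hwin z S₀ τ S F hprem t ht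
    exact ((hcl z S₀ τ S F hprem s ⟨hs.1, hs.2.trans htc⟩).1 0 (2 - (P.K : ℤ)) le_rfl hKH).trans hρD
  · intro z S₀ τ S F hprem t ht i k hk hkH
    obtain ⟨htpos, htc⟩ := hwin z S₀ τ S F hprem t ht
    have htI : t ∈ Icc 0 c₀ := ⟨htpos.le, htc⟩
    have hd := (hcl z S₀ τ S F hprem t htI).1 i (1 + k) (by have h1' : (1 : ℤ) ≤ (P.k₁ : ℤ) := (by exact_mod_cast hk₁); omega)
      (by omega)
    have e : (S - W z) i (1 + k) t = S i (1 + k) t - W z i (1 + k) t := rfl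
    rw [e] at hd
    have h3 := abs_sub_abs_le_abs_sub (S i (1 + k) t) (W z i (1 + k) t)
    have hS : |S i (1 + k) t| ≤ |W z i (1 + k) t| + Dk (1 + k) := by linarith only [hd, h3]
    exact (mul_le_mul_of_nonneg_left (mul_le_mul_of_nonneg_left hS (hw0 k).le) (by norm_num)).trans
      (hrefA z hprem.1 t htI i k hk hkH)
  · intro z S₀ τ S F hprem t ht
    have hd := (hcl z S₀ τ S F hprem t ht).1 1 (kH + 1) hKH le_rfl
    have e : (S - W z) 1 (kH + 1) t = S 1 (kH + 1) t - W z 1 (kH + 1) t := rfl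
    rw [e] at hd
    have h3 := abs_sub_abs_le_abs_sub (S 1 (kH + 1) t) (W z 1 (kH + 1) t)
    linarith only [hd, h3, hrefV z hprem.1 t ht]
  · intro z S₀ τ S F hprem t ht s hs
    obtain ⟨htpos, htc⟩ := hwin z S₀ τ S F hprem t ht
    exact (hcl z S₀ τ S F hprem s ⟨hs.1, hs.2.trans htc⟩).2.1

set_option maxHeartbeats 800000 in
/-- **THE SAME DATA ALONG THE SHORT KICK-BALL FLOWS** (`[0, s]`, `0 < s ≤ c₀`) of `H(n)`, `n > N₀`: the block deviation (hence the
core input `ρ₂` of `zoneLevels_of_schedule_slot` along the short flows), the WINDOW LEVELS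
`|S_{ik}| ≤ M^W_k + D_k` on `2−K ≤ k ≤ k_H+1` (given the reference hull `|W z_{ik}| ≤ M^W_k` there), the cut envelope `2G_{k_H+1}` beyond,
and the interface levels at `1−K` — the window part of the K4 input `hlev` of `apriori_tube_uniform` (…ExistTubeGlue; the near/behind part is
`zoneLevels_of_schedule_slot`, …ZoneLevels).
[cite: Tao2016AveragedNS, §4 Lemma 4.1 (4.5), §5 (statement shape); cell LADDER §47.5 L2 (K4), §70 (A70-3, W-34), referee A-133] -/
theorem tubeLevels_of_conditionalBlock_ball (P : TubeSchedule) {θ' : ℝ} {Wb : ℕ → ℝ} {i₀ : Fin 2}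
    {Bcl : ℕ → (Fin 2 → ℤ → ℝ) → Prop} (hBcl : ∀ m z, Bcl m z → behindR54 P θ' Wb m z)
    {X₀ : Fin 2 → ℝ} {w : ℤ → ℝ} {r c₀ : ℝ} {ζ : ℕ → Fin 2 → ℤ → ℝ} {ustar : Fin 2 → ℤ → ℝ} {n : ℕ}
    {cW κ₂ : ℝ} {W₀ FW₀ BW₀ : (Fin 2 → ℤ → ℝ) → Fin 2 → ℤ → ℝ} {W FW : (Fin 2 → ℤ → ℝ) → Fin 2 → ℤ → ℝ → ℝ}
    (hWflow : ∀ z, InTubeWith P Bcl i₀ X₀ w r ζ ustar n z →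
      PseudoFlowOnShift shiftSetFlat cW ε₀ (mirrorTable ε ε) 0 κ₂ (W₀ z) (FW₀ z) (BW₀ z) (W z) (FW z)) (hcW : c₀ ≤ cW)
    (hε : 0 ≤ ε) (hε₀ : 0 < ε₀) (hn : P.N₀ < n) (hK : 1 ≤ P.K) (hDK : P.K + 1 ≤ P.D) (hθV : 0 < P.θV)
    (hθ : 0 < θ') (hθ5 : θ' ≤ 5 * Real.log (1 + ε₀)) (hw1 : ∀ k, 1 ≤ w k) (hr0 : 0 ≤ r) (hc₀ : 0 < c₀)
    (hAstar : 0 < P.Astar) {ωK MuK : ℝ} (hωK : 0 < ωK)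
    (hωKle : ∀ i, ωK ≤ MirrorPulse.geomGauge P.g P.b i (-(P.K : ℤ))) (hMuK : ∀ i, |ustar i (-(P.K : ℤ))| ≤ MuK)
    (hWbn : 0 ≤ Wb n)
    {Aeff A A₀ A₁ M M₁ M₂ rI RBAR BBAR RHO2 rs I₁ I₂ PUMP μN μB VbarN VbarB EW V₀N V₀B EN : ℝ}
    (hAeff : 0 < Aeff) (hM0 : 0 ≤ M)
    (hM : ∀ z, InTubeWith P Bcl i₀ X₀ w r ζ ustar n z →
      ∀ s ∈ Icc 0 c₀, ∀ i, ∀ m ∈ Finset.Icc (-(P.D : ℤ)) (1 - (P.K : ℤ)), |W z i m s| ≤ M)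
    (hM₁ : ∀ z, InTubeWith P Bcl i₀ X₀ w r ζ ustar n z → ∀ s ∈ Icc 0 c₀, |W z 1 (-(P.K : ℤ)) s| ≤ M₁)
    (hM₂0 : 0 ≤ M₂)
    (hM₂ : ∀ z, InTubeWith P Bcl i₀ X₀ w r ζ ustar n z → ∀ s ∈ Icc 0 c₀, |W z 0 (2 - (P.K : ℤ)) s| ≤ M₂)
    (hEW : ∀ z, InTubeWith P Bcl i₀ X₀ w r ζ ustar n z →
      coMovingEnergyOn (Finset.Icc (1 - (P.D : ℤ)) (-(P.K : ℤ))) P.θV (-(P.K : ℝ))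
        (fun i k _ => anchorScale P i₀ z * ustar i k - W₀ z i k) 0 ≤ EW)
    (hρ0 : 0 ≤ RHO2)
    (hRB0 : 0 < RBAR) (hBB0 : 0 < BBAR) (hRr : RBAR ≤ rI) (hBr : BBAR ≤ rI) (hVN0 : 0 ≤ VbarN)
    (hI₁0 : 0 ≤ I₁) (hI₂0 : 0 ≤ I₂)
    (hI₁ : 2 * (Real.exp (P.θV / 2) - 1) ≤ I₁ * P.θV) (hI₂ : Real.exp P.θV - 1 ≤ I₂ * P.θV)
    (hPUMPdef : PUMP = 1 * c₀ * ((2 + ε) * M * I₁ * Real.sqrt (2 * VbarN) + 2 * I₂ * VbarN))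
    (hlevC : rs + PUMP + 1 * c₀ * ((ε * (M + I₁ * Real.sqrt (2 * VbarN)) + ε * M + ε * BBAR) * RBAR
      + (2 + ε) * M * BBAR + BBAR ^ 2) < RBAR)
    (hlevV : rs + 1 * c₀ * ((M + M₂ + RBAR + RHO2) * BBAR + (1 + 2 * ε) * M * RBAR + ε * RBAR ^ 2
      + (M + 2 * ε * M₂) * RHO2 + ε * RHO2 ^ 2) < BBAR)
    (hAdef : A = Real.sqrt (2 * VbarB) * Real.exp (θ' / 2) * Real.exp (θ' * ((P.D : ℝ) - P.K) / 2) + M)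
    (hA₀def : A₀ = M + rI) (hA₁def : A₁ = M₁ + Real.sqrt (2 * VbarN) * Real.exp (P.θV / 2))
    (hrA : rI ≤ A) (hA₀le : A₀ ≤ Aeff)
    (hV₀Ndef : V₀N = (Real.sqrt (P.v n + (P.δ n / ωK) ^ 2) + Real.sqrt P.D * r + Real.sqrt EW) ^ 2)
    (hV₀Bdef : V₀B = (Real.sqrt (Wb n + (MuK + P.δ n / ωK) ^ 2) + r / Real.sqrt (1 - Real.exp (-θ'))) ^ 2)
    (hENdef : EN = Real.exp (P.θV * ((1 : ℝ) - P.D + P.K)) * ((1 + ε) * 1 * A ^ 2 * (A + M))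
      + 1 * rI * (2 * VbarN + ε * rI * Real.sqrt (2 * VbarN) + (1 + ε) * M * rI))
    (hμN : 0 < μN)
    (hμNle : μN ≤ (1 / c₀) * P.θV - 2 * (1 + ε) * 1 * (A * Real.sinh (P.θV / 2) + M * (3 + Real.exp P.θV)))
    (hμB : 0 < μB) (hμBle : μB ≤ (1 / c₀) * θ' - 2 * (1 + ε) * Aeff * Real.sinh (θ' / 2))
    (hlevN : V₀N + EN * c₀ < VbarN) (hlevB : V₀B + A₁ * A₀ * (A₁ + ε * A₀) * c₀ < VbarB)
    (hclose : Real.sqrt (2 * VbarB) * Real.exp (θ' / 2) ≤ Aeff)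
    (hsec : ∀ z S₀ s S F, InTubeWith P Bcl i₀ X₀ w r ζ ustar n z → (∀ i k, w k * |S₀ i k - z i k| ≤ r) → 0 < s →
      PseudoFlowOnShift shiftSetFlat s ε₀ (mirrorTable ε ε) 0 0 S₀ (fun i k => (1 / 2) * S₀ i k ^ 2) (fun _ _ => 0) S F →
        ∀ i, |(S - W z) i (1 - (P.K : ℤ)) 0| ≤ rs)
    {kH : ℤ} (hKH : 2 - (P.K : ℤ) ≤ kH + 1) (hk₁H : (P.k₁ : ℤ) ≤ kH + 2) {Dk G Ω MW : ℤ → ℝ} {Vtop : ℝ}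
    (hGpos : 0 < G (kH + 1)) (hVtop : 0 ≤ Vtop)
    (hblock : ∀ z S₀ s S F, InTubeWith P Bcl i₀ X₀ w r ζ ustar n z → (∀ i k, w k * |S₀ i k - z i k| ≤ r) → 0 < s →
      PseudoFlowOnShift shiftSetFlat s ε₀ (mirrorTable ε ε) 0 0 S₀ (fun i k => (1 / 2) * S₀ i k ^ 2) (fun _ _ => 0) S F →
        ∀ t ∈ Icc 0 c₀, t ≤ s →
          (∀ s' ∈ Icc 0 t, |(S - W z) 0 (1 - (P.K : ℤ)) s'| ≤ 2 * RBAR ∧ |(S - W z) 1 (1 - (P.K : ℤ)) s'| ≤ 2 * BBAR ∧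
              ∀ i : Fin 2, |S i (kH + 1 + 1) s'| ≤ 4 * G (kH + 1)) →
            ∀ s' ∈ Icc 0 t, ∀ (i : Fin 2) (k : ℤ), 2 - (P.K : ℤ) ≤ k → k ≤ kH + 1 → |(S - W z) i k s'| ≤ Dk k)
    (hρD : Dk (2 - (P.K : ℤ)) ≤ RHO2)
    (hrefV : ∀ z, InTubeWith P Bcl i₀ X₀ w r ζ ustar n z → ∀ s ∈ Icc 0 c₀, |W z 1 (kH + 1) s| + Dk (kH + 1) ≤ Vtop)
    (hMW : ∀ z, InTubeWith P Bcl i₀ X₀ w r ζ ustar n z → ∀ s ∈ Icc 0 c₀, ∀ (i : Fin 2) (k : ℤ), 2 - (P.K : ℤ) ≤ k → k ≤ kH + 1 →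
      |W z i k s| ≤ MW k)
    (hΩ : ∀ j, kH < j → ∀ N : Finset ℤ, (∀ m ∈ N, j < m) → ∑ m ∈ N, (w m)⁻¹ ^ 2 ≤ Ω j)
    (hGΩ : ∀ j, kH < j → 2 * (9 / 8 * r) ^ 2 * Ω j ≤ G j ^ 2)
    (hclose0 : 4 / 3 * c₀ * clock ε₀ (kH + 1) * Vtop * (Vtop + 2 * ε * G (kH + 1)) < G (kH + 1)) :
    ∀ z S₀ s S F, InTubeWith P Bcl i₀ X₀ w r ζ ustar n z → (∀ i k, w k * |S₀ i k - z i k| ≤ r) → 0 < s → s ≤ c₀ →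
      PseudoFlowOnShift shiftSetFlat s ε₀ (mirrorTable ε ε) 0 0 S₀ (fun i k => (1 / 2) * S₀ i k ^ 2) (fun _ _ => 0) S F →
        ∀ t ∈ Icc 0 s, (∀ (i : Fin 2) (k : ℤ), 2 - (P.K : ℤ) ≤ k → k ≤ kH + 1 → |(S - W z) i k t| ≤ Dk k) ∧
          (∀ (i : Fin 2) (k : ℤ), 2 - (P.K : ℤ) ≤ k → k ≤ kH + 1 → |S i k t| ≤ MW k + Dk k) ∧
          (∀ (i : Fin 2) (m : ℤ), kH + 1 < m → |S i m t| ≤ 2 * G (kH + 1)) ∧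
          (|(S - W z) 0 (1 - (P.K : ℤ)) t| ≤ RBAR ∧ |(S - W z) 1 (1 - (P.K : ℤ)) t| ≤ BBAR) := by
  have hw0 : ∀ k, 0 < w k := fun k => lt_of_lt_of_le one_pos (hw1 k)
  intro z S₀ s S F hz hkick hs hsc hS t ht
  have hz' := hz
  have h0 : n ≠ 0 := by omega
  have h1 : ¬ n ≤ P.N₀ := by omega
  simp only [InTubeWith, h0, if_false, h1] at hz'
  obtain ⟨-, -, -, -, hA⟩ := hz'
  have hinit : ∀ N : Finset ℤ, (∀ m ∈ N, kH + 1 < m) → ∑ m ∈ N, ∑ i : Fin 2, S₀ i m ^ 2 ≤ G (kH + 1) ^ 2 :=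
    fun N hN => (initialTail_le_of_clauses P hw0 hr0 hA hkick (j := kH + 1) (by omega) hN
      (hΩ (kH + 1) (by omega) N hN)).trans (hGΩ (kH + 1) (by omega))
  obtain ⟨hIN, hlev, hcut⟩ := tubeBlock_closure P hBcl hWflow hcW hε hε₀ hn hK hDK hθV hθ hθ5 hw1 hr0 hc₀ hAstar hωK hωKle
    hMuK hWbn hAeff hM0 hM hM₁ hM₂0 hM₂ hEW hρ0 hRB0 hBB0 hRr hBr hVN0 hI₁0 hI₂0 hI₁ hI₂ hPUMPdef hlevC hlevV hAdef hA₀def hA₁def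
    hrA hA₀le hV₀Ndef hV₀Bdef hENdef hμN hμNle hμB hμBle hlevN hlevB hclose hz hkick hS hs le_rfl hsc (hsec z S₀ s S F hz hkick hs hS)
    hKH hGpos hVtop (fun t' ht' => hblock z S₀ s S F hz hkick hs hS t' ⟨ht'.1, ht'.2.trans hsc⟩ ht'.2) hρD (hrefV z hz) hinit
    hclose0 t ht
  refine ⟨hIN, fun i k hk1 hk2 => ?_, hcut, hlev⟩
  have hd := hIN i k hk1 hk2
  have e : (S - W z) i k t = S i k t - W z i k t := rfl
  rw [e] at hd
  have h3 := abs_sub_abs_le_abs_sub (S i k t) (W z i k t)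
  linarith only [hd, h3, hMW z hz t ⟨ht.1, ht.2.trans hsc⟩ i k hk1 hk2]

end Class





end Summit.NavierStokesRegularity.NavierStokesRegularity.Theorems.HopTube

end
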